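import Summits.ResolutionOfSingularities.ResolutionOfSingularities.Theorems.FrobeniusLadderFInjectiveMacaulayficationRegularBlowupModelGeneral
import HarnessLib

/-!
# The regular blow-up model of a POSSIBLY NON-NORMAL surface (Lipman) is SUPPORTED OFF THE REGULAR LOCUS: `supp J ⊆ (Reg X₁)ᶜ`
# (crux `FInjectiveMacaulayfication` stmt-ResolutionOfSingularities-15315, chain w45a; the non-normal («General») twin of res-L1-w45a-stub-4's
# `RegularBlowupModelSupported` (normal surfaces, `hnor` everywhere) = the SUPPORT export of
# `RegularBlowupModelGeneral.exists_regular_isBlowup_of_lipman` asked for by res-L1-w45a-stub-1 (g6 closing note 22:37:30Z: «dim ≤ 2 support clause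
# needs lead-1's export `supp J ⊆ (regularLocus)ᶜ`» — the (b3)-support bound in local dimension ≤ 2 for the cluster-growth arena); seat
# res-L1-w45a-lead-1 g7)

[OURS · L1 W4.5a] Support file (`--supports stmt-ResolutionOfSingularities-15315 --as helper`); replaces the role of NO printed item; NOT a statement of
the manuscript; def-free; THEOREMS modulo Lipman 1978 (`Lipman1978SequenceFinite`) BY NAME (S-V is the tree theorem
`FiniteModificationOfBlowup.finiteModificationOfBlowupIsBlowup_holds`); AI-written (AI review is weaker than expert review).

THE POINT. `RegularBlowupModelGeneral.exists_regular_isBlowup_of_lipman (hL)` presents a REGULAR model `π : Y → X₁` of every separated finite-type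
integral `X₁` of dimension `≤ 2` as ONE blowing up along some `J ≠ ⊥`, but records nothing about `supp J`. Here the same tower is re-run with
SUPPORTS TRACKED: Lipman's first step is a blowing up along `Q` with `supp Q = Sing X₁` (`exists_isBlowup_lipmanStep`); at each later step the centre
is `Sing (X_i)`, which lies OVER `Sing X₁` (off `supp Q_i ⊆ Sing X₁` the map `X_i → X₁` is a stalk isomorphism onto regular points, so those points of
`X_i` are regular), hence the composite presentation of Stacks 080B can be taken SUPPORTED in `Sing X₁` (`IsBlowup.exists_isBlowup_comp_supported`),
the Cartier twist `Q₀ · Q_i` keeps the support inside `Sing X₁`, and S-V preserves supports. Result: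

* `exists_isBlowup_step_supported` — THE LINK of `RegularBlowupModelDim2.exists_isBlowup_step` with `supp ⊆ (Reg X₁)ᶜ` carried along;
* `exists_regular_isBlowup_of_iterate_supported` — the tower induction with the support clause;
* **`exists_regular_isBlowup_of_lipman_supported (hL)`** — `∃ Y g π J, J ≠ ⊥ ∧ IsBlowup π J ∧ Scheme.IsRegular Y ∧ supp J ⊆ (Scheme.regularLocus X₁)ᶜ`
  for every separated finite-type integral `X₁` of dimension `≤ 2` (no affineness): the regular model is an isomorphism over `Reg X₁`.
[folklore assembly; cite: Liu2002, Thm. 8.3.44 (PDF p. 427); StacksProject, Tags 080B, 02OS; Matsumura1987, Thm. 19.4]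
-/

-- single-problem summit: the doubled namespace component is forced
set_option linter.dupNamespace false

noncomputable section

open AlgebraicGeometry CategoryTheory Literature.AlgebraicGeometry.Resolution TopologicalSpace

namespace Summit.ResolutionOfSingularities.ResolutionOfSingularities.Theorems.FInjectiveMacaulayfication.RegularBlowupModelGeneralSupported

open Summit.ResolutionOfSingularities.ResolutionOfSingularities.Theorems.FInjectiveMacaulayfication
open Summit.ResolutionOfSingularities.ResolutionOfSingularities.Theorems.FInjectiveMacaulayfication.FCForallExistsDimLe2
open Summit.ResolutionOfSingularities.ResolutionOfSingularities.Theorems.FInjectiveMacaulayfication.RegularBlowupModelDim2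

/-! ## §1 The link, with supports -/

/-- Over a point of `Reg X₁` a blowing up `ρ : S → X₁` supported in `Sing X₁` is a stalk isomorphism onto a regular local ring, so the point
upstairs is regular: **the singular locus of `S` lies over `Sing X₁`**. [folklore; cite: StacksProject, Tag 02OS] -/
theorem singularLocus_subset_preimage {S X₁ : Scheme.{0}} {ρ : S ⟶ X₁} {Q : X₁.IdealSheafData} (hρ : IsBlowup ρ Q)
    (hQC : (Q.support : Set X₁) ⊆ (Scheme.regularLocus X₁)ᶜ) :
    (Scheme.regularLocus S)ᶜ ⊆ ρ.base ⁻¹' (Scheme.regularLocus X₁)ᶜ := by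
  intro y hy
  by_contra hreg
  apply hy
  have hreg' : ρ.base y ∈ Scheme.regularLocus X₁ := not_not.mp hreg
  have hnot : ρ.base y ∉ (Q.support : Set X₁) := fun h => hQC h hreg'
  haveI := isIso_stalkMap_of_isBlowup_of_not_mem hρ y hnot
  haveI : IsRegularLocalRing (X₁.presheaf.stalk (ρ.base y)) := (Scheme.mem_regularLocus _).mp hreg'
  exact (Scheme.mem_regularLocus y).mpr (IsRegularLocalRing.of_ringEquiv (asIso (ρ.stalkMap y)).commRingCatIsoToRingEquiv)

/-- **THE LINK, SUPPORTED.** `RegularBlowupModelDim2.exists_isBlowup_step` with the clause `supp ⊆ (Reg X₁)ᶜ` carried from `Q` to `Q′`: the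
centre `Sing S.X` of the step lies over `Sing X₁` (`singularLocus_subset_preimage`), so the 080B presentation is taken supported in `(Reg X₁)ᶜ`,
the twist by `Q` and S-V keep the support. [folklore assembly; cite: StacksProject, Tags 080B, 02OS] -/
theorem exists_isBlowup_step_supported (hV : FiniteModificationOfBlowupIsBlowup) {k : Type} [Field k] (S : NormalSurface k)
    (X₁ : Scheme.{0}) [IsIntegral X₁] [IsNoetherian X₁] (ρ : S.X ⟶ X₁) (Q : X₁.IdealSheafData) (hρ : IsBlowup ρ Q)
    (hN : ∀ y : X₁, y ∉ (Q.support : Set X₁) → IsIntegrallyClosed (X₁.presheaf.stalk y))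
    (hQC : (Q.support : Set X₁) ⊆ (Scheme.regularLocus X₁)ᶜ) :
    ∃ Q' : X₁.IdealSheafData, Q' ≠ ⊥ ∧ IsBlowup (S.stepπ ≫ ρ) Q' ∧
      (∀ y : X₁, y ∉ (Q'.support : Set X₁) → IsIntegrallyClosed (X₁.presheaf.stalk y)) ∧
      (Q'.support : Set X₁) ⊆ (Scheme.regularLocus X₁)ᶜ := by
  -- the blow-up of the reduced singular locus, the composite centre SUPPORTED in `(Reg X₁)ᶜ` (Stacks 080B), twisted by `Q`
  have hb : IsBlowup (singBlowup.π S.X S.hom) (singularLocusIdeal S.X S.hom) := blowup.isBlowup _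
  have hSingC : ((singularLocusIdeal S.X S.hom).support : Set S.X) ⊆ ρ.base ⁻¹' (Scheme.regularLocus X₁)ᶜ := by
    rw [coe_support_singularLocusIdeal]
    exact singularLocus_subset_preimage hρ hQC
  obtain ⟨Q₀, hQ₀, hQ₀C⟩ := IsBlowup.exists_isBlowup_comp_supported ρ Q (singBlowup.π S.X S.hom) (singularLocusIdeal S.X S.hom)
    ((Scheme.regularLocus X₁)ᶜ) hρ hQC hb hSingC
  have hcart : IsEffectiveCartier (Q.comap (singBlowup.π S.X S.hom ≫ ρ)) := by
    rw [Scheme.IdealSheafData.comap_comp]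
    exact IsEffectiveCartier.comap_of_isBlowup hb hρ.isEffectiveCartier
  have hQ'' : IsBlowup (singBlowup.π S.X S.hom ≫ ρ) (Q₀ * Q) := isBlowup_mul_of_comap hQ₀ hcart
  have hne : Q₀ * Q ≠ ⊥ := ne_bot_of_isBlowup hQ''
  have hsuppC : ((Q₀ * Q).support : Set X₁) ⊆ (Scheme.regularLocus X₁)ᶜ := by
    rw [Scheme.IdealSheafData.support_mul, TopologicalSpace.Closeds.coe_sup]
    exact Set.union_subset hQ₀C hQC
  have hsub : ∀ y : X₁, y ∉ ((Q₀ * Q).support : Set X₁) → y ∉ (Q.support : Set X₁) := by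
    intro y hy h
    apply hy
    rw [Scheme.IdealSheafData.support_mul, TopologicalSpace.Closeds.coe_sup]
    exact Or.inr h
  -- `X' = Bl_{Sing} S.X` is normal over the complement of `supp (Q₀·Q)`
  set c : singBlowup S.X S.hom ⟶ X₁ := singBlowup.π S.X S.hom ≫ ρ with hc
  let V : (singBlowup S.X S.hom).Opens := c ⁻¹ᵁ ⟨((Q₀ * Q).support : Set X₁)ᶜ, (Q₀ * Q).support.isClosed.isOpen_compl⟩
  have hVn : ∀ y ∈ V, IsIntegrallyClosed ((singBlowup S.X S.hom).presheaf.stalk y) := by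
    intro y hy
    have hy' : c.base y ∉ ((Q₀ * Q).support : Set X₁) := hy
    haveI := isIso_stalkMap_of_isBlowup_of_not_mem hQ'' y hy'
    haveI := hN _ (hsub _ hy')
    exact IsIntegrallyClosed.of_equiv (asIso (c.stalkMap y)).commRingCatIsoToRingEquiv
  -- hence the normalisation is an isomorphism over `V`
  have hgen : IsIso ((normalizationι (singBlowup S.X S.hom)).stalkMap (genericPoint (normalization (singBlowup S.X S.hom)))) :=
    (isBirational_normalizationι (singBlowup S.X S.hom) (singBlowup.π S.X S.hom ≫ S.hom)).isIso_stalkMap_genericPoint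
  haveI : IsIso (normalizationι (singBlowup S.X S.hom) ∣_ V) :=
    isIso_morphismRestrict_of_isIntegralHom_of_normal (normalizationι (singBlowup S.X S.hom)) hgen V hVn
  -- S-V (supports are preserved)
  have hsurj : Function.Surjective (normalizationι (singBlowup S.X S.hom)).base :=
    surjective_of_universallyClosed_of_isDominant _
  have hiso : ∀ x₃ : normalization (singBlowup S.X S.hom),
      c.base ((normalizationι (singBlowup S.X S.hom)).base x₃) ∉ ((Q₀ * Q).support : Set X₁) →
      IsIso ((normalizationι (singBlowup S.X S.hom)).stalkMap x₃) :=
    fun x₃ hx₃ => RegularBlowupModelDim2.isIso_stalkMap_of_isIso_morphismRestrict (normalizationι (singBlowup S.X S.hom)) V x₃ hx₃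
  obtain ⟨J, hJ, hJsupp, hJbl⟩ := hV X₁ (singBlowup S.X S.hom) (normalization (singBlowup S.X S.hom)) (Q₀ * Q) c
    (normalizationι (singBlowup S.X S.hom)) inferInstance inferInstance hne hQ'' inferInstance inferInstance hsurj hiso
  refine ⟨J, hJ, ?_, fun y hy => hN y (hsub y (by rwa [hJsupp] at hy)), by rw [hJsupp]; exact hsuppC⟩
  have e : S.stepπ ≫ ρ = normalizationι (singBlowup S.X S.hom) ≫ c := by
    rw [hc, ← Category.assoc]
    rfl
  rw [e]
  exact hJbl

/-! ## §2 The tower induction, with supports -/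

/-- **Tower induction with supports**: if `X_n = step^[n] S` is regular and `S.X → X₁` is a blowing up along `Q` supported in `Sing X₁` off whose
support `X₁` is normal, then some REGULAR `k`-scheme is a blowing up of `X₁` along a non-zero ideal sheaf SUPPORTED IN `Sing X₁`.
[folklore assembly] -/
theorem exists_regular_isBlowup_of_iterate_supported (hV : FiniteModificationOfBlowupIsBlowup) {k : Type} [Field k]
    (X₁ : Scheme.{0}) [IsIntegral X₁] [IsNoetherian X₁] :
    ∀ (n : ℕ) (S : NormalSurface k) (ρ : S.X ⟶ X₁) (Q : X₁.IdealSheafData), IsBlowup ρ Q →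
      (∀ y : X₁, y ∉ (Q.support : Set X₁) → IsIntegrallyClosed (X₁.presheaf.stalk y)) →
      (Q.support : Set X₁) ⊆ (Scheme.regularLocus X₁)ᶜ →
      Scheme.IsRegular (NormalSurface.step^[n] S).X →
      ∃ (Y : Scheme.{0}) (_ : Y ⟶ Spec (.of k)) (π : Y ⟶ X₁) (J : X₁.IdealSheafData),
        J ≠ ⊥ ∧ IsBlowup π J ∧ Scheme.IsRegular Y ∧ (J.support : Set X₁) ⊆ (Scheme.regularLocus X₁)ᶜ := by
  intro n
  induction n with
  | zero =>
    intro S ρ Q hρ _ hQC hreg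
    exact ⟨S.X, S.hom, ρ, Q, ne_bot_of_isBlowup hρ, hρ, hreg, hQC⟩
  | succ n ih =>
    intro S ρ Q hρ hN hQC hreg
    rw [Function.iterate_succ_apply] at hreg
    obtain ⟨Q', -, hbl, hN', hQ'C⟩ := exists_isBlowup_step_supported hV S X₁ ρ Q hρ hN hQC
    exact ih S.step (S.stepπ ≫ ρ) Q' hbl hN' hQ'C hreg

/-! ## §3 The supported regular blow-up model -/

/-- **A REGULAR BLOW-UP MODEL OF A VARIETY OF DIMENSION `≤ 2`, SUPPORTED OFF THE REGULAR LOCUS** (modulo Lipman 1978 BY NAME): for an integral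
separated `k`-scheme `X₁` of finite type with `dim X₁ ≤ 2` there are a REGULAR `k`-scheme `Y`, `π : Y → X₁` and `J ≠ ⊥` with `IsBlowup π J` AND
`supp J ⊆ (Scheme.regularLocus X₁)ᶜ` — the model is an isomorphism over `Reg X₁`. Dimension `≤ 1`: Lipman's first step (centre `Sing X₁`);
dimension `2`: Lipman's sequence and the supported tower induction. [folklore assembly; cite: Liu2002, Thm. 8.3.44 (PDF p. 427)] -/
theorem exists_regular_isBlowup_of_lipman_supported (hL : Lipman1978SequenceFinite.{0}) {k : Type} [Field k] (X₁ : Scheme.{0})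
    (f₁ : X₁ ⟶ Spec (.of k)) [IsSeparated f₁] [LocallyOfFiniteType f₁] [QuasiCompact f₁] [IsIntegral X₁]
    (hdim : topologicalKrullDim X₁ ≤ 2) :
    ∃ (Y : Scheme.{0}) (_ : Y ⟶ Spec (.of k)) (π : Y ⟶ X₁) (J : X₁.IdealSheafData),
      J ≠ ⊥ ∧ IsBlowup π J ∧ Scheme.IsRegular Y ∧ (J.support : Set X₁) ⊆ (Scheme.regularLocus X₁)ᶜ := by
  haveI : IsLocallyNoetherian X₁ := LocallyOfFiniteType.isLocallyNoetherian f₁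
  haveI : CompactSpace X₁ := QuasiCompact.compactSpace_of_compactSpace f₁
  haveI : IsNoetherian X₁ := ⟨⟩
  have hV : FiniteModificationOfBlowupIsBlowup := FiniteModificationOfBlowup.finiteModificationOfBlowupIsBlowup_holds
  obtain ⟨Q, -, hbl, hsupp, hN⟩ := RegularBlowupModelGeneral.exists_isBlowup_lipmanStep X₁ f₁
  have hQC : (Q.support : Set X₁) ⊆ (Scheme.regularLocus X₁)ᶜ := hsupp.le
  rcases le_one_or_eq_two_of_le_two hdim with h1 | h2
  · have h1' : topologicalKrullDim (singBlowup X₁ f₁) ≤ 1 := by rw [singBlowup.topologicalKrullDim_eq X₁ f₁]; exact h1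
    exact ⟨lipmanStep X₁ f₁, lipmanStep.π X₁ f₁ ≫ f₁, lipmanStep.π X₁ f₁, Q, ne_bot_of_isBlowup hbl, hbl,
      isRegular_normalization_of_dim_le_one (singBlowup X₁ f₁) NoetherFiniteIntegralClosure_holds (singBlowup.π X₁ f₁ ≫ f₁) h1', hQC⟩
  · let S : NormalSurface k :=
      { X := lipmanStep X₁ f₁, hom := lipmanStep.π X₁ f₁ ≫ f₁, isSeparated := inferInstance,
        locallyOfFiniteType := inferInstance, quasiCompact := inferInstance, isIntegral := inferInstance,
        normal := lipmanStep.isIntegrallyClosed_stalk X₁ f₁,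
        dim_eq := by rw [lipmanStep.topologicalKrullDim_eq X₁ f₁, h2] }
    obtain ⟨n, hn⟩ := hL k S
    exact exists_regular_isBlowup_of_iterate_supported hV X₁ n S (lipmanStep.π X₁ f₁) Q hbl hN hQC hn

end Summit.ResolutionOfSingularities.ResolutionOfSingularities.Theorems.FInjectiveMacaulayfication.RegularBlowupModelGeneralSupported

end
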